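import Literature.NumberTheory.ModularForms.QAsymptotics2
import HarnessLib

/-!
# Third-order `q`-asymptotics at `i∞`: `E₂, E₄, E₆, Δ` to `O(q³)` and `j = q⁻¹ + 744 + O(q)` (CKMRV (2.1), (2.3))

Cohn–Kumar–Miller–Radchenko–Viazovska, arXiv:1902.05438, §2.1.1 (2.1):
`E₄ = 1 + 240q + 2160q² + ⋯`, `E₆ = 1 − 504q − 16632q² − ⋯`, `Δ = q − 24q² + 252q³ − ⋯`,
`j = q⁻¹ + 744 + 196884q + ⋯`; (2.3) `E₂ = 1 − 24q − 72q² − ⋯`.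

Everything below is proved:
* `isBigO_hasSum_tail_n`: a general `N`-term tail lemma for `q`-series with polynomially bounded
  coefficients (`f − Σ_{n<N} aₙbⁿ = O(‖b‖ᴺ)` along `atImInfty` when `‖b‖ → 0`);
* `E2_third_order`: `E₂ − 1 + 24q + 72q² = O(q³)`; `E₄_third_order`: `E₄ − 1 − 240q − 2160q² = O(q³)`;
  `E₆_third_order`: `E₆ − 1 + 504q + 16632q² = O(q³)` (`σ₁(2) = 3`, `σ₃(2) = 9`, `σ₅(2) = 33`);
* `discriminant_third_order`: `Δ − q + 24q² = O(q³)`;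
* `kleinJ_mul_q_second_order`: `q·j − 1 − 744q = O(q²)`, i.e. `j = q⁻¹ + 744 + O(q)`.

## References

* H. Cohn, A. Kumar, S. D. Miller, D. Radchenko, M. Viazovska, Ann. of Math. 196 (2022),
  arXiv:1902.05438, §2.1.1 (2.1), (2.3). [CohnEtAl2019]
-/

noncomputable section

open Complex hiding I
open Filter Topology Asymptotics ModularForm SlashInvariantForm EisensteinSeries
open UpperHalfPlane hiding I
open Complex (I)
open scoped Real MatrixGroups ModularForm Manifold ArithmeticFunction.sigma

namespace Literature.NumberTheory.ModularForms

open Literature.NumberTheory.EllipticCurves.ModularForms (kleinJ E₄_cube_eq_kleinJ_mul)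

/-! ## The `N`-term tail lemma -/

/-- **`N`-term tail lemma.** If `f(τ) = Σ aₙ b(τ)ⁿ` with `‖aₙ‖ ≤ C nᵏ` for `n ≥ N` (`C ≥ 0`) and
`‖b(τ)‖ → 0` at `i∞`, then `f − Σ_{n<N} aₙbⁿ = O(‖b‖ᴺ)` along `atImInfty`. [folklore] -/
theorem isBigO_hasSum_tail_n {b f : ℍ → ℂ} {a : ℕ → ℂ} {C : ℝ} {k N : ℕ} (hC : 0 ≤ C)
    (ha : ∀ n, N ≤ n → ‖a n‖ ≤ C * (n : ℝ) ^ k) (hb0 : Tendsto (fun τ => ‖b τ‖) atImInfty (𝓝 0))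
    (hf : ∀ τ, HasSum (fun n => a n * b τ ^ n) (f τ)) :
    (fun τ => f τ - ∑ n ∈ Finset.range N, a n * b τ ^ n) =O[atImInfty] fun τ => ‖b τ‖ ^ N := by
  have hgeom : Summable fun m : ℕ => ((m + N : ℕ) : ℝ) ^ k * (1 / 2 : ℝ) ^ (m + N) := by
    have := summable_pow_mul_geometric_of_norm_lt_one k (r := (1 / 2 : ℝ)) (by norm_num)
    exact (summable_nat_add_iff N).mpr this
  set S : ℝ := ∑' m : ℕ, C * (((m + N : ℕ) : ℝ) ^ k * (1 / 2 : ℝ) ^ (m + N) * 2 ^ N) with hS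
  have hSsum : HasSum (fun m : ℕ => C * (((m + N : ℕ) : ℝ) ^ k * (1 / 2 : ℝ) ^ (m + N) * 2 ^ N)) S :=
    ((hgeom.mul_right _).mul_left C).hasSum
  refine IsBigO.of_bound S ?_
  have hev : ∀ᶠ τ : ℍ in atImInfty, ‖b τ‖ ≤ 1 / 2 :=
    (hb0.eventually (eventually_le_nhds (by norm_num : (0 : ℝ) < 1 / 2)))
  filter_upwards [hev] with τ hτ
  have htail : HasSum (fun m : ℕ => a (m + N) * b τ ^ (m + N)) (f τ - ∑ n ∈ Finset.range N, a n * b τ ^ n) :=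
    (hasSum_nat_add_iff' N).mpr (hf τ)
  rw [Real.norm_of_nonneg (pow_nonneg (norm_nonneg _) _), ← htail.tsum_eq]
  refine tsum_of_norm_bounded (hSsum.mul_right (‖b τ‖ ^ N)) fun m => ?_
  rw [norm_mul, norm_pow]
  have h1 : ‖a (m + N)‖ ≤ C * ((m + N : ℕ) : ℝ) ^ k := by exact_mod_cast ha (m + N) (by omega)
  have h2 : ‖b τ‖ ^ (m + N) ≤ (1 / 2 : ℝ) ^ m * ‖b τ‖ ^ N := by
    rw [pow_add]
    exact mul_le_mul_of_nonneg_right (pow_le_pow_left₀ (norm_nonneg _) hτ m) (pow_nonneg (norm_nonneg _) _)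
  have h3 : (1 / 2 : ℝ) ^ m = (1 / 2 : ℝ) ^ (m + N) * 2 ^ N := by
    rw [pow_add, mul_assoc, ← mul_pow]; norm_num
  calc ‖a (m + N)‖ * ‖b τ‖ ^ (m + N) ≤ (C * ((m + N : ℕ) : ℝ) ^ k) * ((1 / 2 : ℝ) ^ m * ‖b τ‖ ^ N) :=
        mul_le_mul h1 h2 (pow_nonneg (norm_nonneg _) _) (mul_nonneg hC (pow_nonneg (by positivity) _))
    _ = C * (((m + N : ℕ) : ℝ) ^ k * (1 / 2 : ℝ) ^ (m + N) * 2 ^ N) * ‖b τ‖ ^ N := by rw [h3]; ring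

/-! ## Small values of `σ` -/

/-- `σₖ(1) = 1`, `σₖ(2) = 1 + 2ᵏ`. [folklore] -/
theorem sigma_two (k : ℕ) : σ k 2 = 1 + 2 ^ k := by
  rw [ArithmeticFunction.sigma_apply, show Nat.divisors 2 = {1, 2} by decide, Finset.sum_pair (by norm_num)]
  simp

/-! ## `E₂, E₄, E₆` to third order -/

/-- **`E₂ − 1 + 24q + 72q² = O(q³)`** (CKMRV (2.3)). [cite: CohnEtAl2019, §2.1.1 (2.3)] -/
theorem E2_third_order :
    (fun τ : ℍ => E2 τ - 1 + 24 * qfun τ + 72 * qfun τ ^ 2) =O[atImInfty] fun τ => expDecay τ ^ 3 := by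
  set a : ℕ → ℂ := fun m => if m = 0 then 1 else -24 * (σ 1 m : ℂ) with ha
  have hbound : ∀ n, 3 ≤ n → ‖a n‖ ≤ 24 * (n : ℝ) ^ 2 := by
    intro n hn
    simp only [ha, if_neg (show n ≠ 0 by omega)]
    rw [norm_mul, norm_neg, show ‖(24 : ℂ)‖ = 24 by norm_num]
    exact mul_le_mul_of_nonneg_left (norm_sigma_le 1 n) (by norm_num)
  have hsum : ∀ τ : ℍ, HasSum (fun n => a n * qfun τ ^ n) (E2 τ) := fun τ => by
    have := EisensteinSeries.hasSum_qExpansion_E2 (z := τ)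
    simpa [ha, qfun, smul_eq_mul] using this
  have h := isBigO_hasSum_tail_n (N := 3) (by norm_num) hbound tendsto_norm_qfun hsum
  refine (h.congr_left fun τ => ?_).congr_right fun τ => by rw [norm_qfun]
  simp [ha, Finset.sum_range_succ, ArithmeticFunction.sigma_one_apply, show Nat.divisors 2 = {1, 2} by decide]
  ring

open Literature.NumberTheory.Automorphic (E₄_qExpansion_coeff) in
/-- **`E₄ − 1 − 240q − 2160q² = O(q³)`** (CKMRV (2.1); `240σ₃(2) = 2160`). [cite: CohnEtAl2019, §2.1.1 (2.1)] -/
theorem E₄_third_order :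
    (fun τ : ℍ => E₄ τ - 1 - 240 * qfun τ - 2160 * qfun τ ^ 2) =O[atImInfty] fun τ => expDecay τ ^ 3 := by
  set a : ℕ → ℂ := fun m => (qExpansion 1 E₄).coeff m with ha
  have hcoeff : ∀ m, a m = if m = 0 then 1 else 240 * (σ 3 m : ℂ) := fun m => E₄_qExpansion_coeff m
  have hbound : ∀ n, 3 ≤ n → ‖a n‖ ≤ 240 * (n : ℝ) ^ 4 := by
    intro n hn
    rw [hcoeff, if_neg (show n ≠ 0 by omega), norm_mul, show ‖(240 : ℂ)‖ = 240 by norm_num]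
    exact mul_le_mul_of_nonneg_left (norm_sigma_le 3 n) (by norm_num)
  have h := isBigO_hasSum_tail_n (N := 3) (by norm_num) hbound tendsto_norm_qfun (hasSum_levelOne_qfun E₄)
  refine (h.congr_left fun τ => ?_).congr_right fun τ => by rw [norm_qfun]
  simp only [Finset.sum_range_succ, Finset.sum_range_zero, hcoeff, sigma_two]
  norm_num
  ring

open Literature.NumberTheory.Automorphic (E₆_qExpansion_coeff) in
/-- **`E₆ − 1 + 504q + 16632q² = O(q³)`** (CKMRV (2.1); `504σ₅(2) = 16632`). [cite: CohnEtAl2019, §2.1.1 (2.1)] -/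
theorem E₆_third_order :
    (fun τ : ℍ => E₆ τ - 1 + 504 * qfun τ + 16632 * qfun τ ^ 2) =O[atImInfty] fun τ => expDecay τ ^ 3 := by
  set a : ℕ → ℂ := fun m => (qExpansion 1 E₆).coeff m with ha
  have hcoeff : ∀ m, a m = if m = 0 then 1 else -504 * (σ 5 m : ℂ) := fun m => E₆_qExpansion_coeff m
  have hbound : ∀ n, 3 ≤ n → ‖a n‖ ≤ 504 * (n : ℝ) ^ 6 := by
    intro n hn
    rw [hcoeff, if_neg (show n ≠ 0 by omega), norm_mul, norm_neg, show ‖(504 : ℂ)‖ = 504 by norm_num]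
    exact mul_le_mul_of_nonneg_left (norm_sigma_le 5 n) (by norm_num)
  have h := isBigO_hasSum_tail_n (N := 3) (by norm_num) hbound tendsto_norm_qfun (hasSum_levelOne_qfun E₆)
  refine (h.congr_left fun τ => ?_).congr_right fun τ => by rw [norm_qfun]
  simp only [Finset.sum_range_succ, Finset.sum_range_zero, hcoeff, sigma_two]
  norm_num
  ring

/-! ## `Δ = q − 24q² + O(q³)` and `j = q⁻¹ + 744 + O(q)` -/

/-- Comparisons `q = O(e^{−2πy})`, `e^{−2πy} = O(1)`, and monotonicity of powers. [folklore] -/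
theorem qfun_isBigO : (fun τ => qfun τ) =O[atImInfty] fun τ => expDecay τ :=
  IsBigO.of_bound 1 (Eventually.of_forall fun τ => by
    rw [norm_qfun, Real.norm_of_nonneg (expDecay_pos τ).le, one_mul])

/-- `expDecay_isBigO_one'` (auxiliary). [folklore] -/
theorem expDecay_isBigO_one' : (fun τ => expDecay τ) =O[atImInfty] fun _ : ℍ => (1 : ℝ) :=
  IsBigO.of_bound 1 (Eventually.of_forall fun τ => by
    simp [Real.norm_of_nonneg (expDecay_pos τ).le, expDecay_le_one τ])

/-- `expDecay_pow_isBigO_pow` (auxiliary). [folklore] -/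
theorem expDecay_pow_isBigO_pow {m n : ℕ} (h : n ≤ m) :
    (fun τ => expDecay τ ^ m) =O[atImInfty] fun τ => expDecay τ ^ n :=
  IsBigO.of_bound 1 (Eventually.of_forall fun τ => by
    rw [Real.norm_of_nonneg (pow_nonneg (expDecay_pos τ).le _),
      Real.norm_of_nonneg (pow_nonneg (expDecay_pos τ).le _), one_mul]
    exact pow_le_pow_of_le_one (expDecay_pos τ).le (expDecay_le_one τ) h)

/-- **`Δ − q + 24q² = O(q³)`** (CKMRV (2.1)), from `1728Δ = E₄³ − E₆²` and the third-order
expansions of `E₄`, `E₆`. [cite: CohnEtAl2019, §2.1.1 (2.1)] -/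
theorem discriminant_third_order :
    (fun τ : ℍ => ModularForm.discriminant τ - qfun τ + 24 * qfun τ ^ 2) =O[atImInfty] fun τ => expDecay τ ^ 3 := by
  -- `E₄ = 1 + X`, `X = 240q + 2160q² + A`; `E₆ = 1 + Y`, `Y = −504q − 16632q² + B`; `A, B = O(q³)`
  have hA := E₄_third_order
  have hB := E₆_third_order
  have hX : (fun τ : ℍ => E₄ τ - 1) =O[atImInfty] expDecay := E₄_sub_one_isBigO
  have hY : (fun τ : ℍ => E₆ τ - 1) =O[atImInfty] expDecay := E₆_sub_one_isBigO
  have hX2 := E₄_second_order   -- `E₄ − 1 − 240q = O(q²)`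
  have hY2 := E₆_second_order   -- `E₆ − 1 + 504q = O(q²)`
  have hq := qfun_isBigO
  have hq1 : (fun τ => qfun τ) =O[atImInfty] fun _ : ℍ => (1 : ℝ) := hq.trans expDecay_isBigO_one'
  -- `1728(Δ − q + 24q²) = 3A − 2B + (3X² − 172800q² + X³) − (Y² − 254016q²)`, and
  -- `3X² − 172800q² = 3(X − 240q)(X + 240q)`, `Y² − 254016q² = (Y + 504q)(Y − 504q)`
  have hform : ∀ τ : ℍ, ModularForm.discriminant τ - qfun τ + 24 * qfun τ ^ 2 =
      (1728 : ℂ)⁻¹ * (3 * (E₄ τ - 1 - 240 * qfun τ - 2160 * qfun τ ^ 2) - 2 * (E₆ τ - 1 + 504 * qfun τ + 16632 * qfun τ ^ 2)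
        + 3 * ((E₄ τ - 1 - 240 * qfun τ) * ((E₄ τ - 1) + 240 * qfun τ))
        + (E₄ τ - 1) * ((E₄ τ - 1) * (E₄ τ - 1))
        - (E₆ τ - 1 + 504 * qfun τ) * ((E₆ τ - 1) - 504 * qfun τ)) := by
    intro τ
    rw [ModularForm.discriminant_eq_E₄_cube_sub_E₆_sq τ]
    ring
  have t1 := hA.const_mul_left 3
  have t2 := hB.const_mul_left 2
  have t3 : (fun τ => 3 * ((E₄ τ - 1 - 240 * qfun τ) * ((E₄ τ - 1) + 240 * qfun τ))) =O[atImInfty]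
      fun τ => expDecay τ ^ 3 := by
    have hb : (fun τ => (E₄ τ - 1) + 240 * qfun τ) =O[atImInfty] expDecay := hX.add (hq.const_mul_left 240)
    have := (hX2.mul hb).const_mul_left 3
    exact this.congr_right fun τ => by ring
  have t4 : (fun τ => (E₄ τ - 1) * ((E₄ τ - 1) * (E₄ τ - 1))) =O[atImInfty] fun τ => expDecay τ ^ 3 := by
    have := hX.mul (hX.mul hX)
    exact this.congr_right fun τ => by ring
  have t5 : (fun τ => (E₆ τ - 1 + 504 * qfun τ) * ((E₆ τ - 1) - 504 * qfun τ)) =O[atImInfty]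
      fun τ => expDecay τ ^ 3 := by
    have hb : (fun τ => (E₆ τ - 1) - 504 * qfun τ) =O[atImInfty] expDecay := hY.sub (hq.const_mul_left 504)
    have := hY2.mul hb
    exact this.congr_right fun τ => by ring
  have total := ((((t1.sub t2).add t3).add t4).sub t5).const_mul_left ((1728 : ℂ)⁻¹)
  exact total.congr' (Eventually.of_forall fun τ => by beta_reduce; rw [hform τ]) EventuallyEq.rfl

/-- **`q·j − 1 − 744q = O(q²)`**, i.e. `j = q⁻¹ + 744 + O(q)` (CKMRV (2.1)): `qj·Δ = qE₄³` with
`E₄³ = 1 + 720q + O(q²)` and `Δ = q(1 − 24q + O(q²))`. [cite: CohnEtAl2019, §2.1.1 (2.1)] -/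
theorem kleinJ_mul_q_second_order :
    (fun τ : ℍ => qfun τ * kleinJ τ - 1 - 744 * qfun τ) =O[atImInfty] fun τ => expDecay τ ^ 2 := by
  have hΔ3 := discriminant_third_order
  have hX2 := E₄_second_order
  have hX : (fun τ : ℍ => E₄ τ - 1) =O[atImInfty] expDecay := E₄_sub_one_isBigO
  have hq := qfun_isBigO
  have hq1 : (fun τ => qfun τ) =O[atImInfty] fun _ : ℍ => (1 : ℝ) := hq.trans expDecay_isBigO_one'
  -- `Δ/q → 1`: eventually `‖Δ/q‖ ≥ 1/2`, so division by `Δ/q` is harmless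
  have hP : Tendsto (fun τ : ℍ => ModularForm.discriminant τ * (qfun τ)⁻¹) atImInfty (𝓝 1) := by
    refine tendsto_exp_mul_discriminant.congr fun τ => ?_
    rw [qfun, Complex.exp_neg]; ring
  have hev : ∀ᶠ τ : ℍ in atImInfty, 1 / 2 ≤ ‖ModularForm.discriminant τ * (qfun τ)⁻¹‖ := by
    have := (continuous_norm.tendsto (1 : ℂ)).comp hP
    rw [norm_one] at this
    exact this.eventually (eventually_ge_nhds (by norm_num : (1 / 2 : ℝ) < 1))
  -- the numerator `N = qE₄³ − (1 + 744q)Δ = O(q³)`: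
  -- `N = q(E₄³ − 1 − 720q) − (Δ − q + 24q²) − 744q(Δ − q)` hmm; precisely
  -- `qE₄³ − (1+744q)Δ = q[(E₄−1)³ + 3(E₄−1)² + 3(E₄ − 1 − 240q)] + 720q² − (Δ − q + 24q²) + 24q² − 744qΔ + ...`
  have hN : (fun τ : ℍ => qfun τ * E₄ τ ^ 3 - (1 + 744 * qfun τ) * ModularForm.discriminant τ) =O[atImInfty]
      fun τ => expDecay τ ^ 3 := by
    have hform : ∀ τ : ℍ, qfun τ * E₄ τ ^ 3 - (1 + 744 * qfun τ) * ModularForm.discriminant τ =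
        qfun τ * ((E₄ τ - 1) * ((E₄ τ - 1) * (E₄ τ - 1)) + 3 * ((E₄ τ - 1) * (E₄ τ - 1 - 240 * qfun τ))
          + 3 * (240 * qfun τ) * (E₄ τ - 1 - 240 * qfun τ) + 3 * (E₄ τ - 1 - 240 * qfun τ))
        - (ModularForm.discriminant τ - qfun τ + 24 * qfun τ ^ 2)
        - 744 * qfun τ * (ModularForm.discriminant τ - qfun τ + 24 * qfun τ ^ 2)
        + 24 * 744 * qfun τ ^ 3 + 3 * 240 ^ 2 * qfun τ ^ 3 := by
      intro τ; ring
    have hXX : (fun τ => (E₄ τ - 1) * ((E₄ τ - 1) * (E₄ τ - 1))) =O[atImInfty] fun τ => expDecay τ ^ 2 := by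
      have := (hX.trans expDecay_isBigO_one').mul (hX.mul hX)
      simpa [sq] using this
    have hin : (fun τ => (E₄ τ - 1) * ((E₄ τ - 1) * (E₄ τ - 1)) + 3 * ((E₄ τ - 1) * (E₄ τ - 1 - 240 * qfun τ))
          + 3 * (240 * qfun τ) * (E₄ τ - 1 - 240 * qfun τ) + 3 * (E₄ τ - 1 - 240 * qfun τ)) =O[atImInfty]
        fun τ => expDecay τ ^ 2 := by
      have a2 : (fun τ => 3 * ((E₄ τ - 1) * (E₄ τ - 1 - 240 * qfun τ))) =O[atImInfty] fun τ => expDecay τ ^ 2 := by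
        simpa using ((hX.trans expDecay_isBigO_one').mul hX2).const_mul_left 3
      have a3 : (fun τ => 3 * (240 * qfun τ) * (E₄ τ - 1 - 240 * qfun τ)) =O[atImInfty] fun τ => expDecay τ ^ 2 := by
        have := (hq1.mul hX2).const_mul_left (3 * 240)
        refine (this.congr_left fun τ => by ring).congr_right fun τ => by ring
      exact ((hXX.add a2).add a3).add (hX2.const_mul_left 3)
    have t1 : (fun τ => qfun τ * ((E₄ τ - 1) * ((E₄ τ - 1) * (E₄ τ - 1)) + 3 * ((E₄ τ - 1) * (E₄ τ - 1 - 240 * qfun τ))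
          + 3 * (240 * qfun τ) * (E₄ τ - 1 - 240 * qfun τ) + 3 * (E₄ τ - 1 - 240 * qfun τ))) =O[atImInfty]
        fun τ => expDecay τ ^ 3 := by
      have := hq.mul hin
      exact this.congr_right fun τ => by ring
    have t3 : (fun τ => 744 * qfun τ * (ModularForm.discriminant τ - qfun τ + 24 * qfun τ ^ 2)) =O[atImInfty]
        fun τ => expDecay τ ^ 3 := by
      have := (hq1.mul hΔ3).const_mul_left 744
      refine (this.congr_left fun τ => by ring).congr_right fun τ => by ring
    have t4 : (fun τ => 24 * 744 * qfun τ ^ 3 + 3 * 240 ^ 2 * qfun τ ^ 3) =O[atImInfty] fun τ => expDecay τ ^ 3 := by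
      have h3 : (fun τ => qfun τ ^ 3) =O[atImInfty] fun τ => expDecay τ ^ 3 := by simpa using hq.pow 3
      exact ((h3.const_mul_left _).add (h3.const_mul_left _))
    exact (((t1.sub hΔ3).sub t3).add t4).congr' (Eventually.of_forall fun τ => by
      beta_reduce; rw [hform τ]; ring) EventuallyEq.rfl
  -- divide by `Δ/q`: `q j − 1 − 744 q = N / Δ · (1)`… precisely `qj − 1 − 744q = N/(Δ/q) · q⁻¹ · ...`:
  -- `qj = qE₄³/Δ`, so `qj − 1 − 744q = (qE₄³ − (1+744q)Δ)/Δ = N/Δ = (N/q)/(Δ/q)`.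
  obtain ⟨C, hC⟩ := hN.bound
  set G : ℍ → ℂ := fun τ => (qfun τ * E₄ τ ^ 3 - (1 + 744 * qfun τ) * ModularForm.discriminant τ) * (qfun τ)⁻¹ *
    (ModularForm.discriminant τ * (qfun τ)⁻¹)⁻¹ with hGdef
  have hG : G =O[atImInfty] fun τ => expDecay τ ^ 2 := by
    refine IsBigO.of_bound (2 * C) ?_
    filter_upwards [hC, hev] with τ hτ hP2
    rw [Real.norm_of_nonneg (pow_nonneg (expDecay_pos τ).le 3)] at hτ
    rw [hGdef, norm_mul, norm_mul, norm_inv, norm_inv, norm_qfun, Real.norm_of_nonneg (sq_nonneg _)]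
    have hr := expDecay_pos τ
    have hPpos : 0 < ‖ModularForm.discriminant τ * (qfun τ)⁻¹‖ := by linarith
    rw [mul_inv_le_iff₀ hPpos]
    have hC0 : 0 ≤ C * expDecay τ ^ 2 := by
      have := (norm_nonneg _).trans hτ
      nlinarith [pow_pos hr 3, pow_pos hr 2]
    calc ‖qfun τ * E₄ τ ^ 3 - (1 + 744 * qfun τ) * ModularForm.discriminant τ‖ * (expDecay τ)⁻¹
        ≤ C * expDecay τ ^ 3 * (expDecay τ)⁻¹ := mul_le_mul_of_nonneg_right hτ (inv_nonneg.2 hr.le)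
      _ = C * expDecay τ ^ 2 := by field_simp
      _ ≤ 2 * C * expDecay τ ^ 2 * ‖ModularForm.discriminant τ * (qfun τ)⁻¹‖ := by nlinarith
  refine hG.congr' (Eventually.of_forall fun τ => ?_) EventuallyEq.rfl
  have hq0 : qfun τ ≠ 0 := Complex.exp_ne_zero _
  have hΔ0 := ModularForm.discriminant_ne_zero τ
  have hj : kleinJ τ = E₄ τ ^ 3 / ModularForm.discriminant τ := by
    rw [eq_div_iff hΔ0]; exact (E₄_cube_eq_kleinJ_mul τ).symm
  simp only [hGdef, hj]
  field_simp
  ring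

end Literature.NumberTheory.ModularForms
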